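import Literature.NumberTheory.GaloisRepresentations.IdeleCarryClassLocalInvariant
import Literature.NumberTheory.NumberFields.DecompositionGroupsPrescribed
import Literature.Algebra.Homology.NormResidueSymbolInertia
import HarnessLib

/-!
# The norm residue symbol of THE canonical fundamental class `u_{E/F}` of a cyclic layer `(Gal(E/F), C_E)` IS the
# Artin map (Tate, *Global class field theory*, C–F VII §11.3: the norm residue map of the class formation
# coincides with the reciprocity map of §5; Serre, *Local Fields* XI §3)

Topic `NumberTheory/GaloisRepresentations`; namespace `Literature.NumberTheory.GaloisRepresentations.IdeleCohomology`
(sequel to `IdeleClassCarryInvariant`, `IdeleCarryClassLocalInvariant`).  Theorems only (no definition, no named fact,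
no instance, no notation, no `sorry`); number fields in `Type`.

Let `E/F` be a CYCLIC extension of number fields, `G = Gal(E/F) = ⟨σ⟩` of order `n`, `ψ = ψ_{E/F}` THE Artin map of
the tree's reciprocity law (`artinIdeleMapOfAlgebra F E`, `ker ψ = Fˣ N_{E/F} 𝕀_E`, uniformiser idèles at unramified
places go to Frobenii), `classInv : H²(G, C_E) ⥲ (1/n)ℤ/ℤ` the invariant map and `u_{E/F} = fundamentalClass F E`
(`classInv u_{E/F} = 1/n`, door-c6 g12), `ι_σ(g) ∈ {0, …, n−1}` the exponent `σ^{ι_σ(g)} = g`.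

* §1 **`carryInv_eq_neg_exponent_artin`**: `classInv [c_σ · ι[x]] = −ι_σ(ψ x)/n ∈ ℚ/ℤ` for every idèle `x` of `F` —
  i.e. `inv(ι[x] · δχ_σ) = −χ_σ(ψ x)` for the character `χ_σ(σ) = 1/n` (the injective character `carryInvChar σ` of
  `IdeleClassCarryInvariant` is `g ↦ −χ_σ(g)`).  Proof: Chebotarev (tree `exists_place_stabilizer_eq_zpowers`) gives a
  place `v` unramified in `E` with a place `w ∣ v` of full decomposition group and Frobenius `σ`; there
  `ψ(⟨ϖ_v⟩_v) = σ` and `carryInv σ ⟨ϖ_v⟩_v = −1/n` (`IdeleCarryClassLocalInvariant`); conclude by `carryInvChar`.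
* §2 **`H2π_eq_fundamentalClass_of_normResidueSymbol_eq_artin`**: a fundamental class of the layer whose norm residue
  symbol is `ψ` (the tree's `IdeleClassGroup.exists_isClassModule_normResidueSymbol_eq`) IS `u_{E/F}` — its `classInv`
  is `−ι_σ(σ⁻¹)/n = −(n−1)/n = 1/n`.
* §3 **`normResidueSymbol_baseInvariant_eq_artin`**: for EVERY cocycle `φ` with `IsClassModule (galoisRep F E) φ` and
  `[φ] = u_{E/F}`: `(ι[x], E/F)_φ = ψ_{E/F}(x)` in `Gal(E/F)^{ab}` for all idèles `x` (engine
  `IsClassModule.normResidueSymbol_congr`: the symbol depends only on the class); `exists_isClassModule_fundamentalClass_artin`.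

HONEST FRAMING: this is Tate's §11.3 for CYCLIC layers in the tree's normalisations (`classInv` through door-c5's
idèle invariants and door-c6's dictionary to THE local invariant maps; the engine's norm residue symbol; the tree's
Artin map).  Arbitrary layers (through the inflation-compatible invariant of door-c5 g15) and the passage to `Γ_F`
are not treated here.  No case of BSD and no case of Poitou–Tate `Ker γ¹ ⊆ Im β¹` is proved; written for Route A of
crux `AnticycControlAdditiveK` (cell bsd-schneider): it identifies the class formation's reciprocity pairing
`a ↦ inv(a ∪ δχ)` with THE Artin map, so that door-c6 g11's `α¹(Γ_F, ℤ/m)` results (stated for an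
`IsGlobalReciprocityMap`) bear on the class formation `(Gal(E/F), C_E)`.

## References
* J. W. S. Cassels, A. Fröhlich (eds.), *Algebraic Number Theory* (1967), Ch. VII (J. Tate) §11.3, §5.1 (B), §11.2.
  [CasselsFrohlichANT1967]
* J.-P. Serre, *Local Fields*, GTM 67 (1979), XI §3 (the norm residue symbol of a class formation), XIII §4.
  [SerreLocalFields1979]
* J. Neukirch, *Algebraic Number Theory* (1999), Ch. VII Thm. (13.4) (Chebotarev). [NeukirchANT1999]
* J. Neukirch, *Class Field Theory — The Bonn Lectures* (2013), Part II §1 Thm. (1.9), I §5 Prop. (5.8). [Neukirch2013]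
-/

noncomputable section

open NumberField IsDedekindDomain CategoryTheory groupCohomology Function Field
open Literature.NumberTheory.Automorphic

namespace Literature.NumberTheory.GaloisRepresentations

namespace IdeleCohomology

open SemiLocal Literature.Algebra.Homology IdeleClassGroup Literature.NumberTheory.NumberFields
open Literature.AnabelianGeometry.AbsoluteAnabelian.Prop121vii (zmodToQmodZ zmodToQmodZ_apply)

variable {F : Type} [Field F] [NumberField F] {E : Type} [Field E] [NumberField E] [Algebra F E] [IsGalois F E]
variable [IsCyclic (E ≃ₐ[F] E)] (σ : E ≃ₐ[F] E) (hσ : ∀ g, g ∈ Subgroup.zpowers σ)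

/-! ## §1. `classInv [c_σ · ι[x]] = −ι_σ(ψ x)/n` -/

omit [IsCyclic (E ≃ₐ[F] E)] in
include hσ in
/-- **Chebotarev input**: a finite place `v` of `F`, unramified in `E`, with a place `w ∣ v` of FULL decomposition group
and `galFrob F E v = σ` (a place above a prime whose Frobenius is the generator `σ`; tree
`exists_place_stabilizer_eq_zpowers` + `eq_galFrob`). [cite: NeukirchANT1999, Ch. VII Thm. (13.4)][cite: CasselsFrohlichANT1967, Ch. VII §11.3] -/
theorem exists_place_stabilizer_eq_top_galFrob_eq (hcomm : ∀ a b : E ≃ₐ[F] E, Commute a b) :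
    ∃ (v : HeightOneSpectrum (𝓞 F)) (w : Place F E v), Algebra.IsUnramifiedIn (𝓞 E) v.asIdeal ∧
      MulAction.stabilizer (E ≃ₐ[F] E) w = ⊤ ∧ galFrob F E v = σ := by
  obtain ⟨q, W, -, hunr, hW, hfrob, hstab⟩ := exists_place_stabilizer_eq_zpowers (F := F) (L := E) σ
  have hunder : W.under (𝓞 F) = q :=
    HeightOneSpectrum.ext (by rw [HeightOneSpectrum.under_asIdeal]; exact hW.2.over.symm)
  let w : Place F E q := ⟨W, hunder⟩
  refine ⟨q, w, hunr, ?_, (eq_galFrob hcomm hunr hW hfrob).symm⟩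
  refine (Subgroup.eq_top_iff' _).2 fun τ => ?_
  rw [MulAction.mem_stabilizer_iff]
  refine Place.ext ?_
  rw [Place.coe_smul]
  have hτ : τ ∈ MulAction.stabilizer (E ≃ₐ[F] E) W := by rw [hstab]; exact hσ τ
  exact MulAction.mem_stabilizer_iff.1 hτ

/-- `k • (−(a/n)) = −(k a / n)` in `ℚ/ℤ` for naturals read in `ℚ`. [folklore] -/
private theorem nsmul_neg_coe_div (k a n : ℕ) :
    k • (-((((a : ℚ)) / n : ℚ) : AddCircle (1 : ℚ))) = -(((((k * a : ℕ) : ℚ)) / n : ℚ) : AddCircle (1 : ℚ)) := by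
  rw [smul_neg, ← AddCircle.coe_nsmul, nsmul_eq_mul, Nat.cast_mul, mul_div_assoc]

/-- **`classInv [c_σ · ι[x]] = −ι_σ(ψ_{E/F} x)/n`** for every idèle `x` of `F` (`n = #Gal(E/F)`, `σ^{ι_σ(g)} = g`): the
invariant of the cup product of `ι[x]` with `δχ_σ` is `−χ_σ(ψ x)`, `χ_σ(σ) = 1/n` — Tate's §11.3 identity between
the class formation's pairing and the Artin map, at a cyclic layer, in the tree's normalisations.
[cite: CasselsFrohlichANT1967, Ch. VII §11.3][cite: SerreLocalFields1979, Ch. XI §3] -/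
theorem carryInv_eq_neg_exponent_artin (x : ideleGroup F) :
    carryInv (E := E) σ hσ x =
      -(((((Unramified.exponent σ hσ
            (haveI := IsAbelianGalois.of_isCyclic F E; artinIdeleMapOfAlgebra F E artinReciprocity_character_holds x) : ℕ) : ℚ)) /
          (Nat.card (E ≃ₐ[F] E) : ℕ) : ℚ) : AddCircle (1 : ℚ)) := by
  classical
  haveI := IsAbelianGalois.of_isCyclic F E
  have hcomm : ∀ a b : E ≃ₐ[F] E, Commute a b := fun a b => IsMulCommutative.is_comm.comm a b
  set ψ := artinIdeleMapOfAlgebra F E artinReciprocity_character_holds with hψ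
  -- the Chebotarev place and the value there
  obtain ⟨v, w, hunr, hstab, hfrob⟩ := exists_place_stabilizer_eq_top_galFrob_eq (F := F) (E := E) σ hσ hcomm
  set x₁ : ideleGroup F := localUnits v (HeckeCharacter.uniformizer F v) with hx₁
  have hψx₁ : ψ x₁ = σ := by
    rw [hψ, hx₁, ← hfrob]
    exact (artinIdeleMapOfAlgebra_frobenius F E artinReciprocity_character_holds hunr).1
  have hx₁val := carryInv_localUnits_uniformizer (E := E) σ hσ hcomm w hunr hstab hfrob
  -- `ψ x = σ ^ k`, `k = ι_σ(ψ x)`, so `carryInvChar (ψ x) = carryInvChar (ψ x₁) ^ k`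
  set k := Unramified.exponent σ hσ (ψ x) with hk
  have hpow : ψ x = ψ (x₁ ^ (k : ℤ)) := by rw [map_zpow, hψx₁, zpow_natCast, hk, Unramified.pow_exponent]
  rw [carryInv_eq_of_artin_eq σ hσ hpow, carryInv_zpow σ hσ x₁ k, natCast_zsmul, hx₁val, nsmul_neg_coe_div]
  -- `k * (1 % n) / n = k / n` in `ℚ/ℤ`
  by_cases h1 : Nat.card (E ≃ₐ[F] E) = 1
  · rw [h1, Nat.mod_self, mul_zero, Nat.cast_zero, zero_div, Nat.cast_one, div_one, AddCircle.coe_zero, neg_zero,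
      ← Int.cast_natCast, ← zsmul_one, AddCircle.coe_zsmul, AddCircle.coe_period, smul_zero, neg_zero]
  · have h1lt : (1 : ℕ) < Nat.card (E ≃ₐ[F] E) := lt_of_le_of_ne Nat.card_pos (Ne.symm h1)
    rw [Nat.mod_eq_of_lt h1lt, mul_one]

/-- **`carryInvChar σ g = −ι_σ(g)/n`**: the injective character of `IdeleClassCarryInvariant` is `g ↦ −χ_σ(g)`.
[cite: CasselsFrohlichANT1967, Ch. VII §11.3][cite: SerreLocalFields1979, Ch. XI §3] -/
theorem carryInvChar_eq_neg_exponent (g : E ≃ₐ[F] E) :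
    carryInvChar (E := E) σ hσ g =
      Multiplicative.ofAdd (-(((((Unramified.exponent σ hσ g : ℕ) : ℚ)) / (Nat.card (E ≃ₐ[F] E) : ℕ) : ℚ) :
        AddCircle (1 : ℚ))) := by
  haveI := IsAbelianGalois.of_isCyclic F E
  obtain ⟨x, rfl⟩ := artinIdeleMapOfAlgebra_surjective F E artinReciprocity_character_holds g
  rw [carryInvChar_artin, carryInv_eq_neg_exponent_artin]

/-! ## §2. The Artin-normalised fundamental class is THE canonical class -/

omit [NumberField F] [NumberField E] [IsGalois F E] [IsCyclic (E ≃ₐ[F] E)] in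
/-- `Gal(E/F)^{ab} = Gal(E/F)` for an abelian layer: `Abelianization.of` is injective. [folklore] -/
private theorem abelianizationOf_injective (hcomm : ∀ a b : E ≃ₐ[F] E, Commute a b) :
    Injective (Abelianization.of : (E ≃ₐ[F] E) → Abelianization (E ≃ₐ[F] E)) := by
  haveI : IsMulCommutative (E ≃ₐ[F] E) := ⟨⟨fun a b => (hcomm a b).eq⟩⟩
  intro a b hab
  have h := (QuotientGroup.eq (s := commutator (E ≃ₐ[F] E))).1 hab
  rw [commutator_eq_bot, Subgroup.mem_bot, inv_mul_eq_one] at h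
  exact h

/-- **A fundamental class of the cyclic layer `(Gal(E/F), C_E)` whose norm residue symbol is the Artin map IS
`u_{E/F}`**: if `IsClassModule (galoisRep F E) φ` and `(ι[x], E/F)_φ = ψ_{E/F}(x)` for all idèles `x`, then
`[φ] = fundamentalClass F E` (`classInv [φ] = 1/n`: `[φ] = [c_σ · Σ_τ φ(τ, σ)]`, `Σ_τ φ(τ,σ) = ι[x₀]` with
`ψ x₀ = σ⁻¹`, and `classInv [c_σ · ι[x₀]] = −ι_σ(σ⁻¹)/n = 1/n`).
[cite: CasselsFrohlichANT1967, Ch. VII §11.3][cite: Neukirch2013, Part II §1 Thm. (1.9)] -/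
theorem H2π_eq_fundamentalClass_of_normResidueSymbol_eq_artin {φ : cocycles₂ (galoisRep F E)}
    (hA : IsClassModule (galoisRep F E) φ)
    (hφ : ∀ x : ideleGroup F, hA.normResidueSymbol (baseInvariant x) =
      Abelianization.of (haveI := IsAbelianGalois.of_isCyclic F E; artinIdeleMapOfAlgebra F E artinReciprocity_character_holds x)) :
    H2π (galoisRep F E) φ = fundamentalClass F E := by
  classical
  haveI := IsAbelianGalois.of_isCyclic F E
  haveI : NeZero (Nat.card (E ≃ₐ[F] E)) := ⟨Nat.card_pos.ne'⟩
  have hcomm : ∀ a b : E ≃ₐ[F] E, Commute a b := fun a b => IsMulCommutative.is_comm.comm a b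
  obtain ⟨σ, hσ⟩ := IsCyclic.exists_generator (α := E ≃ₐ[F] E)
  set ψ := artinIdeleMapOfAlgebra F E artinReciprocity_character_holds with hψ
  obtain ⟨x₀, hx₀⟩ := baseInvariant_surjective (F := F) (E := E) (Nakayama.nakayamaSum φ σ)
  -- `ψ x₀ = σ⁻¹`
  have hψx₀ : ψ x₀ = σ⁻¹ := by
    apply abelianizationOf_injective hcomm
    rw [← hφ x₀, hx₀, hA.normResidueSymbol_nakayamaSum, map_inv]
  -- `[φ] = [c_σ · ι[x₀]]`, so `classInv [φ] = carryInv σ x₀ = −ι_σ(σ⁻¹)/n`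
  have h1 : H2π (galoisRep F E) φ = FiniteCyclic.carryClassHom σ hσ (galoisRep F E) (baseInvariant x₀) := by
    rw [hx₀, FiniteCyclic.carryClassHom_nakayamaSum]
  apply eq_fundamentalClass_of_classInv_eq
  rw [h1, ← carryInv_apply, carryInv_eq_neg_exponent_artin σ hσ x₀, ← hψ, hψx₀, zmodToQmodZ_apply,
    ZMod.val_one_eq_one_mod]
  -- `ι_σ(σ⁻¹) = n − 1` and `−(n−1)/n = (1 % n)/n` in `ℚ/ℤ`
  have hn : 0 < Fintype.card (E ≃ₐ[F] E) := Fintype.card_pos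
  have hexp : Unramified.exponent σ hσ σ⁻¹ = Fintype.card (E ≃ₐ[F] E) - 1 := by
    have h : σ ^ (Fintype.card (E ≃ₐ[F] E) - 1) = σ⁻¹ := by
      rw [eq_inv_iff_mul_eq_one, ← pow_succ, Nat.sub_add_cancel hn, pow_card_eq_one]
    rw [← h, Unramified.exponent_pow, Nat.mod_eq_of_lt (Nat.sub_lt hn Nat.one_pos)]
  rw [hexp, ← Fintype.card_eq_nat_card, neg_eq_iff_add_eq_zero, ← AddCircle.coe_add, ← add_div, ← Nat.cast_add]
  by_cases h1' : Fintype.card (E ≃ₐ[F] E) = 1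
  · rw [h1', Nat.sub_self, Nat.mod_self, add_zero, Nat.cast_zero, zero_div, AddCircle.coe_zero]
  · rw [Nat.mod_eq_of_lt (lt_of_le_of_ne hn (Ne.symm h1')), Nat.sub_add_cancel hn,
      div_self (Nat.cast_ne_zero.2 hn.ne'), AddCircle.coe_period]

/-! ## §3. The norm residue symbol of `u_{E/F}` is the Artin map -/

/-- **Tate, C–F VII §11.3 for a cyclic layer: the norm residue symbol of THE canonical fundamental class `u_{E/F}` of
`(Gal(E/F), C_E)` is THE Artin map** — for every cocycle `φ` with `IsClassModule (galoisRep F E) φ` and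
`[φ] = fundamentalClass F E`: `(ι[x], E/F)_φ = ψ_{E/F}(x)` in `Gal(E/F)^{ab}` for all idèles `x` of `F` (the symbol
depends only on the class, engine `IsClassModule.normResidueSymbol_congr`; and the Artin-normalised class of the tree's
`IdeleClassGroup.exists_isClassModule_normResidueSymbol_eq` is `u_{E/F}`, §2).
[cite: CasselsFrohlichANT1967, Ch. VII §11.3][cite: SerreLocalFields1979, Ch. XI §3][cite: Neukirch2013, Part I §5 Prop. (5.8)] -/
theorem normResidueSymbol_baseInvariant_eq_artin {φ : cocycles₂ (galoisRep F E)} (hA : IsClassModule (galoisRep F E) φ)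
    (hφ : H2π (galoisRep F E) φ = fundamentalClass F E) (x : ideleGroup F) :
    hA.normResidueSymbol (baseInvariant x) =
      Abelianization.of (haveI := IsAbelianGalois.of_isCyclic F E; artinIdeleMapOfAlgebra F E artinReciprocity_character_holds x) := by
  haveI := IsAbelianGalois.of_isCyclic F E
  obtain ⟨φ₀, hA₀, hφ₀⟩ := IdeleClassGroup.exists_isClassModule_normResidueSymbol_eq (F := F) (E := E)
    (artinIdeleMapOfAlgebra F E artinReciprocity_character_holds) (artinIdeleMapOfAlgebra_surjective F E _)
    (ker_artinIdeleMapOfAlgebra F E _)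
  have h0 : H2π (galoisRep F E) φ₀ = fundamentalClass F E :=
    H2π_eq_fundamentalClass_of_normResidueSymbol_eq_artin hA₀ hφ₀
  rw [hA.normResidueSymbol_congr hA₀ (hφ.trans h0.symm)]
  exact hφ₀ x

/-- **THE canonical class has a cocycle representative, and every such representative has norm residue symbol `ψ_{E/F}`
with kernel `Fˣ N_{E/F} 𝕀_E`** (existence: `IdeleClassInvariantCyclic.exists_isClassModule_H2π_eq_fundamentalClass`).
[cite: CasselsFrohlichANT1967, Ch. VII §11.3][cite: SerreLocalFields1979, Ch. XI §3] -/
theorem exists_isClassModule_fundamentalClass_artin :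
    ∃ (φ : cocycles₂ (galoisRep F E)) (hA : IsClassModule (galoisRep F E) φ),
      H2π (galoisRep F E) φ = fundamentalClass F E ∧
        ∀ x : ideleGroup F, hA.normResidueSymbol (baseInvariant x) =
          Abelianization.of (haveI := IsAbelianGalois.of_isCyclic F E;
            artinIdeleMapOfAlgebra F E artinReciprocity_character_holds x) := by
  obtain ⟨φ, hA, hφ⟩ := exists_isClassModule_H2π_eq_fundamentalClass (F := F) (E := E)
  exact ⟨φ, hA, hφ, normResidueSymbol_baseInvariant_eq_artin hA hφ⟩

end IdeleCohomology

end Literature.NumberTheory.GaloisRepresentations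

end
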